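import Literature.MathematicalPhysics.QuantumLattice.HubbardShiftedSliceGram
import Literature.MathematicalPhysics.QuantumLattice.HubbardGridPropagatorGram
import HarnessLib

/-!
# The Gram constants of the grid fields: single (shifted) Salmhofer slices, `κ² ≲ Λ′²/Λ`

Topic `MathematicalPhysics/QuantumLattice`; the grid-field form (`HubbardGridPropagatorGram`: fields at the points of the time grid
`{jβ/N} × (ℤ/L)²`, Gram vectors `gridGramF/G`, `‖F_X‖² = Σ_k (βL²)⁻² ‖p(k,σ)‖`) of `HubbardShiftedSliceGram.norm_sq_sectorGramF_shiftedSlice_le`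
(Benfatto–Giuliani–Mastropietro 2006, (2.80): the Gram constant of a single-scale propagator is the sup of its symbol times the
phase-space count of its support).  For the shifted slice symbol `(w_Λ - w_{Λ′})·βL²/(-i(ω+θ)+ξ)` (`0 < Λ ≤ Λ′ ≤ d₀/2`, `|θ| ≤ π/(4β)`):

* `norm_sq_gridGramF_le`, `norm_sq_gridGramG_le` — `‖F_X‖² ≤ (βL²)^{-2} · #T · S` for a symbol of sup `S` supported in `T`;
* **`norm_sq_gridGramF_shiftedSlice_le`**, **`norm_sq_gridGramG_shiftedSlice_le`** —
  `‖F_X‖², ‖G_Y‖² ≤ (βL²)^{-2} · (Λ′β/π + 3) · 4L(Λ′L/(2π√(d₀/8)) + 1) · (8/3)βL²/Λ ≍ Λ′²/Λ`, uniformly in `N` and the grid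
  points — the Gram constants `κ_j²` of the infrared slices of the `βU ≤ κ` corner (cell gate-hubbard-kl, R0-SCOPE-4 W1).

Everything is proved; no definitions, no named facts.

## Sources

G. Benfatto, A. Giuliani, V. Mastropietro, Ann. Henri Poincaré 7 (2006) 809–898, §2.8 (2.80) and footnote ¹
(`BenfattoGiulianiMastropietro2006`); M. Salmhofer, *Renormalization* (1999), §4.2.5 (4.70)–(4.71) (`Salmhofer1999`).
-/

noncomputable section

namespace Literature.MathematicalPhysics.QuantumLattice

open Literature.Probability.LatticeModels GrassmannAlgebra Finset
open scoped InnerProductSpace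

variable {L M : ℕ} [NeZero L] {P : Type*}

/-! ### Sup times count -/

/-- **`‖F_X‖² ≤ (βL²)^{-2} · #T · S`** for a symbol bounded by `S` and supported in `T` (in the spin of `X`).
[cite: BenfattoGiulianiMastropietro2006, §2.8 (2.80)] -/
theorem norm_sq_gridGramF_le (β : ℝ) (x : P → TorusSite 2 L) (τ : P → ℝ) (p : FreqMomentum L M × Fin 2 → ℂ) (X : GridLeg P)
    {S : ℝ} (hS : ∀ k, ‖p (k, X.1.2)‖ ≤ S) (T : Finset (FreqMomentum L M)) (hT : ∀ k, p (k, X.1.2) ≠ 0 → k ∈ T) :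
    ‖gridGramF L M β x τ p X‖ ^ 2 ≤ ‖((1 / (β * (L : ℝ) ^ 2) : ℝ) : ℂ)‖ ^ 2 * (T.card * S) := by
  rw [norm_sq_gridGramF, ← mul_sum]
  refine mul_le_mul_of_nonneg_left (sum_le_card_mul_of_support _ hS T fun k hk => hT k fun h => hk ?_) (by positivity)
  rw [h, norm_zero]

/-- The same for the right Gram vector. [cite: BenfattoGiulianiMastropietro2006, §2.8 (2.80)] -/
theorem norm_sq_gridGramG_le (β : ℝ) (x : P → TorusSite 2 L) (τ : P → ℝ) (p : FreqMomentum L M × Fin 2 → ℂ) (Y : GridLeg P)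
    {S : ℝ} (hS : ∀ k, ‖p (k, Y.1.2)‖ ≤ S) (T : Finset (FreqMomentum L M)) (hT : ∀ k, p (k, Y.1.2) ≠ 0 → k ∈ T) :
    ‖gridGramG L M β x τ p Y‖ ^ 2 ≤ ‖((1 / (β * (L : ℝ) ^ 2) : ℝ) : ℂ)‖ ^ 2 * (T.card * S) := by
  rw [norm_sq_gridGramG, ← mul_sum]
  refine mul_le_mul_of_nonneg_left (sum_le_card_mul_of_support _ hS T fun k hk => hT k fun h => hk ?_) (by positivity)
  rw [h, norm_zero]

/-! ### The shifted Salmhofer slice -/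

/-- The support of the slice symbol lies in the shell `{|ω| ≤ Λ′} × {|ε(k⃗) - μ| < Λ′}`. [cite: Salmhofer1999, §4.2.5 (4.71)] -/
theorem mem_shell_of_sliceSymbol_ne_zero {β : ℝ} (μ θ : ℝ) {Λ Λ' : ℝ} (hΛ : 0 < Λ) (hΛΛ' : Λ ≤ Λ') (k : FreqMomentum L M)
    (σ : Fin 2)
    (hp : ((hubbardCutoffWeight L M β μ Λ k : ℂ) - (hubbardCutoffWeight L M β μ Λ' k : ℂ)) * shiftedFreeSymbol L M β μ θ (k, σ) ≠ 0) :
    k ∈ (univ : Finset (FreqMomentum L M)).filter fun k => |matsubaraFreq β M k.1| ≤ Λ' ∧ |torusBand L k.2 - μ| < Λ' := by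
  have hΛ' : 0 < Λ' := hΛ.trans_le hΛΛ'
  have hw : hubbardCutoffWeight L M β μ Λ k - hubbardCutoffWeight L M β μ Λ' k ≠ 0 := by
    intro h0
    apply hp
    have : ((hubbardCutoffWeight L M β μ Λ k : ℂ) - (hubbardCutoffWeight L M β μ Λ' k : ℂ)) = 0 := by exact_mod_cast h0
    simp only [this, zero_mul]
  obtain ⟨-, hhi⟩ := support_sliceWeight hΛ hΛΛ' k hw
  rw [mem_filter]
  refine ⟨mem_univ _, ?_, ?_⟩
  · have : matsubaraFreq β M k.1 ^ 2 ≤ Λ' ^ 2 := by nlinarith [sq_nonneg (nambuXi L μ k.2)]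
    exact abs_le_of_sq_le_sq' this hΛ'.le |>.elim (fun h1 h2 => abs_le.2 ⟨h1, h2⟩)
  · have hξ : nambuXi L μ k.2 ^ 2 < Λ' ^ 2 := by nlinarith [sq_nonneg (matsubaraFreq β M k.1)]
    have := abs_lt_of_sq_lt_sq' hξ hΛ'.le
    rw [nambuXi] at this
    exact abs_lt.2 this

/-- **The Gram constant of a shifted slice on the grid** (left vector): for `0 < β`, `0 < Λ ≤ Λ′ ≤ d₀/2` with `μ` at distance `≥ d₀` from
`{-4, 0}` and `|θ| ≤ π/(4β)`, `‖F_X‖² ≤ (βL²)^{-2} · [(Λ′β/π + 3) · 4L(Λ′L/(2π√(d₀/8)) + 1)] · (8/3)βL²/Λ ≍ Λ′²/Λ`, for every set of grid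
points and every leg `X`. [cite: BenfattoGiulianiMastropietro2006, §2.8 (2.80)] -/
theorem norm_sq_gridGramF_shiftedSlice_le {β : ℝ} (hβ : 0 < β) {μ d₀ : ℝ} (hμ4 : d₀ ≤ μ + 4) (hμ0 : d₀ ≤ -μ) {θ : ℝ}
    (hθ : |θ| ≤ Real.pi / (4 * β)) {Λ Λ' : ℝ} (hΛ : 0 < Λ) (hΛΛ' : Λ ≤ Λ') (hΛ'd : Λ' ≤ d₀ / 2)
    (x : P → TorusSite 2 L) (τ : P → ℝ) (X : GridLeg P) :
    ‖gridGramF L M β x τ (fun ks => ((hubbardCutoffWeight L M β μ Λ ks.1 : ℂ) - (hubbardCutoffWeight L M β μ Λ' ks.1 : ℂ)) *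
        shiftedFreeSymbol L M β μ θ ks) X‖ ^ 2 ≤
      ‖((1 / (β * (L : ℝ) ^ 2) : ℝ) : ℂ)‖ ^ 2 *
        (((Λ' * β / Real.pi + 3) * (4 * (L * (Λ' * L / (2 * Real.pi * Real.sqrt (d₀ / 8)) + 1)))) *
          (8 / 3 * (β * (L : ℝ) ^ 2) / Λ)) := by
  classical
  have hΛ' : 0 < Λ' := hΛ.trans_le hΛΛ'
  refine (norm_sq_gridGramF_le β x τ _ X (fun k => norm_sliceSymbol_le hβ μ hθ hΛ hΛΛ' (k, X.1.2)) _
    fun k hk => mem_shell_of_sliceSymbol_ne_zero μ θ hΛ hΛΛ' k X.1.2 hk).trans ?_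
  exact mul_le_mul_of_nonneg_left (mul_le_mul_of_nonneg_right (card_shellSupport_le hβ hμ4 hμ0 hΛ' hΛ'd) (by positivity))
    (by positivity)

/-- **The Gram constant of a shifted slice on the grid** (right vector). [cite: BenfattoGiulianiMastropietro2006, §2.8 (2.80)] -/
theorem norm_sq_gridGramG_shiftedSlice_le {β : ℝ} (hβ : 0 < β) {μ d₀ : ℝ} (hμ4 : d₀ ≤ μ + 4) (hμ0 : d₀ ≤ -μ) {θ : ℝ}
    (hθ : |θ| ≤ Real.pi / (4 * β)) {Λ Λ' : ℝ} (hΛ : 0 < Λ) (hΛΛ' : Λ ≤ Λ') (hΛ'd : Λ' ≤ d₀ / 2)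
    (x : P → TorusSite 2 L) (τ : P → ℝ) (Y : GridLeg P) :
    ‖gridGramG L M β x τ (fun ks => ((hubbardCutoffWeight L M β μ Λ ks.1 : ℂ) - (hubbardCutoffWeight L M β μ Λ' ks.1 : ℂ)) *
        shiftedFreeSymbol L M β μ θ ks) Y‖ ^ 2 ≤
      ‖((1 / (β * (L : ℝ) ^ 2) : ℝ) : ℂ)‖ ^ 2 *
        (((Λ' * β / Real.pi + 3) * (4 * (L * (Λ' * L / (2 * Real.pi * Real.sqrt (d₀ / 8)) + 1)))) *
          (8 / 3 * (β * (L : ℝ) ^ 2) / Λ)) := by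
  classical
  have hΛ' : 0 < Λ' := hΛ.trans_le hΛΛ'
  refine (norm_sq_gridGramG_le β x τ _ Y (fun k => norm_sliceSymbol_le hβ μ hθ hΛ hΛΛ' (k, Y.1.2)) _
    fun k hk => mem_shell_of_sliceSymbol_ne_zero μ θ hΛ hΛΛ' k Y.1.2 hk).trans ?_
  exact mul_le_mul_of_nonneg_left (mul_le_mul_of_nonneg_right (card_shellSupport_le hβ hμ4 hμ0 hΛ' hΛ'd) (by positivity))
    (by positivity)

end Literature.MathematicalPhysics.QuantumLattice

end
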